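import Summits.CriticalPhenomena.PercolationContinuityZ3.Theorems.PercNearOneGluingNoHeavyLowerTailSunflowerAttachPrelim
import HarnessLib

/-!
# `NoHeavyLowerTail` (crux stmt-CriticalPhenomena-4575), abstract sunflower cubic: ATTACHING A VERTEX OF ANY DEGREE —
# the reduction of `TriangleFreeSafe` (G△) to HIT-CONDITIONED SAFETY

Support file (seat `prim-ineq-prove-1` gen 49; `--supports stmt-CriticalPhenomena-4575`).  No `sorry`, no named facts.
Memo: run/shared/lean/prim/prim-ineq-prove-1/FINDING-PENDANT-prove1-g49.md §6.  Definitions (`Attach.hit`, `delN`, `HitSafe`, `attachEv`)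
and their measure identities are in `…SunflowerAttachPrelim`.

SETTING (`…SunflowerSafeCalculus`, `…SunflowerSafeMinors`).  `μ = prodBernoulli p` on `Set ι`; `Safe p A`; "A-safe" = safe at every `p`.
Every triangle-free graph is obtained from a smaller one by ATTACHING a new vertex `z` to an independent set `N` (its neighbourhood);
on cores this is `A ↦ A ∪ {ω | z ∈ ω ∧ ω meets N}`.  Conditioning on `z` and on the event `hit N = {ω | ω meets N}` (probability `1 − q`)
writes the measure of a petal `W ⊇ core` as
  `μ(W) = t[(1−q)·1 + q·y] + (1−t)[q·m + V]`,  `y = μ(delN N W¹)` (`z` present, `N` absent), `m = μ(delN N W⁰)`, `V = μ(W⁰ ∩ hit N)`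
(`W¹ = secOn z W`, `W⁰ = secOff z W`, `delN N X = {ω | ω ∖ N ∈ X}`), which is LETTER FOR LETTER the pendant computation of
`…SunflowerPendant` with `s ↔ 1 − q`; the analytic lemma `Pendant.pendant_prod_le` therefore applies as soon as its three product
hypotheses hold: safety of `A` (for the `W⁰`), safety of `delN N A` (for the `delN N W¹`), and
* **`HitSafe p N A`** — HIT-CONDITIONED SAFETY: for every finite family of up-sets meeting pairwise inside `A`,
  `∏ μ(V_i ∩ hit N) ≤ μ(A ∩ hit N)^(n−1) · μ(hit N)`, i.e. Lemma A in product form under the conditional law `μ(· | ω meets N)`.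
THEOREM **`safe_union_attach`**: `z ∉ N`, `A` an up-set not depending on `z`, `Safe p A`, `Safe p (delN N A)`, `HitSafe p N A` ⟹
`Safe p (A ∪ {ω | z ∈ ω ∧ ω meets N})`.  **`aSafe_union_attach`**: the same with A-safety of `A` alone plus `HitSafe` at every `p`
(`delN` of an A-safe core is A-safe, by iterating `aSafe_delMinor`).  GRAPH FORM **`aSafe_edgeCore_attach`**: if `z` is isolated in `Γ₀`,
`z ∉ N`, `edgeCore Γ₀` is A-safe and hit-conditioned safe w.r.t. `N` at every `p`, then the core of `Γ₀` plus the star `{zx : x ∈ N}` is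
A-safe.  CONSEQUENCE (memo §6, THEOREM 4): the conjecture G△ follows from `HitSafe` for all triangle-free cores and independent `N`
(induction on the number of vertices); `HitSafe` for the paths with `N` = the two ends gives every cycle.  For `|N| = 1` hit-conditioned
safety is safety of the contraction minor and the theorem is `…SunflowerPendant.safe_union_pendant`.
EVIDENCE / SHARPNESS (memo §6): `HitSafe` holds in an exact census (all connected triangle-free graphs on ≤ 6 vertices, `C₇–C₉`, `P₇`,
`P₈`, `M₈`, `X₉`, Petersen, `Q₃`, trees; `K = 3,4`; `|N| = 2,3`; adversarial `p`; kit j195172) and is proved for bipartite graphs with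
`N` inside one side; conditioning on TWO hitting events fails, and `HitSafe` is not implied by safety of product sub-sections.
-/

noncomputable section

namespace Summit.CriticalPhenomena.PercolationContinuityZ3.Theorems.SunflowerPartition

namespace SafeCalc

open MeasureTheory Finset
open Literature.Probability.LatticeModels Literature.Probability.Percolation

variable {ι : Type*} [Fintype ι] [DecidableEq ι] (p : ι → unitInterval)

namespace Attach

/-! ## The main theorem -/

/-- **SAFETY IS PRESERVED BY ATTACHING A VERTEX, GIVEN HIT-CONDITIONED SAFETY (fixed `p`).**  Let `z ∉ N`, `A` an up-set not
depending on `z`, and suppose `A`, `delN N A` are safe at `p` and `A` is hit-conditioned safe w.r.t. `N` at `p`.  Then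
`A ∪ {ω | z ∈ ω ∧ ω meets N}` is safe at `p`. [this work] -/
theorem safe_union_attach {z : ι} {N : Finset ι} (hz : z ∉ N) {A : Set (Set ι)}
    (hd : DeterminedBy A (↑(univ.erase z : Finset ι) : Set ι)) (hu : IsUpperSet A) (hA : Safe p A)
    (hB : Safe p (delN N A)) (hH : HitSafe p N A) : Safe p (A ∪ attachEv z N) := by
  classical
  intro n V hV hcap
  set C : Set (Set ι) := A ∪ attachEv z N with hC
  have hCup : IsUpperSet C := hu.union (isUpperSet_attachEv z N)
  -- enlarge the petals so that they contain the core
  set W : Fin n → Set (Set ι) := fun i => V i ∪ C with hW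
  have hWup : ∀ i, IsUpperSet (W i) := fun i => (hV i).union hCup
  have hWC : ∀ i, C ⊆ W i := fun i => Set.subset_union_right
  have hWcap : ∀ i j, i ≠ j → W i ∩ W j ⊆ C := by
    intro i j hij ω hω
    rcases hω with ⟨h1 | h1, h2 | h2⟩
    · exact hcap i j hij ⟨h1, h2⟩
    exacts [h2, h1, h1]
  have hmono : ∀ i, (prodBernoulli p).real (V i) ≤ (prodBernoulli p).real (W i) :=
    fun i => measureReal_mono Set.subset_union_left
  -- sections of the core at `z`
  obtain ⟨eOn, eOff⟩ := secOn_secOff_attachEv hz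
  obtain ⟨aOn, aOff⟩ := secOn_secOff_of_determinedBy hd
  have hC1 : secOn z C = A ∪ hit N := by
    show secOn z A ∪ secOn z (attachEv z N) = _; rw [aOn, eOn]
  have hC0 : secOff z C = A := by
    show secOff z A ∪ secOff z (attachEv z N) = _; rw [aOff, eOff, Set.union_empty]
  -- the two sections of the petals
  set W1 : Fin n → Set (Set ι) := fun i => secOn z (W i) with hW1
  set W0 : Fin n → Set (Set ι) := fun i => secOff z (W i) with hW0
  have hW1up : ∀ i, IsUpperSet (W1 i) := fun i => isUpperSet_secOn z (hWup i)
  have hW0up : ∀ i, IsUpperSet (W0 i) := fun i => isUpperSet_secOff z (hWup i)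
  have hW1C : ∀ i, A ∪ hit N ⊆ W1 i := fun i => by rw [← hC1]; exact fun ω hω => hWC i hω
  have hW0A : ∀ i, A ⊆ W0 i := fun i => by rw [← hC0]; exact fun ω hω => hWC i hω
  have hW01 : ∀ i, W0 i ⊆ W1 i := fun i ω hω => insert_mem_of_mem_secOff z (hWup i) hω
  have hW0cap : ∀ i j, i ≠ j → W0 i ∩ W0 j ⊆ A := by
    intro i j hij ω hω; rw [← hC0]; exact hWcap i j hij hω
  have hW1cap : ∀ i j, i ≠ j → W1 i ∩ W1 j ⊆ A ∪ hit N := by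
    intro i j hij ω hω; rw [← hC1]; exact hWcap i j hij hω
  -- notation
  set t : ℝ := ((p z : unitInterval) : ℝ) with ht
  set q : ℝ := (prodBernoulli p).real (hit N)ᶜ with hq
  set b : ℝ := (prodBernoulli p).real (delN N A) with hbdef
  set VA : ℝ := (prodBernoulli p).real (A ∩ hit N) with hVA
  set y : Fin n → ℝ := fun i => (prodBernoulli p).real (delN N (W1 i)) with hy
  set m : Fin n → ℝ := fun i => (prodBernoulli p).real (delN N (W0 i)) with hm
  set Vv : Fin n → ℝ := fun i => (prodBernoulli p).real (W0 i ∩ hit N) with hVv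
  have ht0 : 0 ≤ t := (p z).2.1
  have ht1 : t ≤ 1 := (p z).2.2
  have hq0 : 0 ≤ q := measureReal_nonneg
  have hq1 : q ≤ 1 := measureReal_le_one
  have hhit : (prodBernoulli p).real (hit N) = 1 - q := by
    have := measureReal_add_measureReal_compl (μ := prodBernoulli p) (s := hit N) MeasurableSet.of_discrete
    rw [probReal_univ] at this; linarith
  have hb0 : 0 ≤ b := measureReal_nonneg
  have hVA0 : 0 ≤ VA := measureReal_nonneg
  have hVv0 : ∀ i, 0 ≤ Vv i := fun i => measureReal_nonneg
  have hy1 : ∀ i, y i ≤ 1 := fun i => measureReal_le_one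
  have hm0 : ∀ i, 0 ≤ m i := fun i => measureReal_nonneg
  -- decompositions of the measures
  have hWdec : ∀ i, (prodBernoulli p).real (W i) = t * (prodBernoulli p).real (W1 i) + (1 - t) * (prodBernoulli p).real (W0 i) :=
    fun i => real_eq_secOn_secOff p z (W i)
  have hW1dec : ∀ i, (prodBernoulli p).real (W1 i) = (1 - q) + q * y i := by
    intro i
    rw [real_eq_hit_add p N (W1 i), Set.inter_eq_right.2 ((Set.subset_union_right).trans (hW1C i)), hhit]
  have hW0dec : ∀ i, (prodBernoulli p).real (W0 i) = Vv i + q * m i := fun i => real_eq_hit_add p N (W0 i)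
  have hAdec : (prodBernoulli p).real A = VA + q * b := real_eq_hit_add p N A
  have hCdec : (prodBernoulli p).real C = t * ((1 - q) + q * b) + (1 - t) * (VA + q * b) := by
    rw [real_eq_secOn_secOff p z C, hC1, hC0, real_eq_hit_add p N (A ∪ hit N), Set.inter_eq_right.2 Set.subset_union_right,
      hhit, delN_union, delN_hit, Set.union_empty, hAdec]
  -- bounds
  have hyb : ∀ i, b ≤ y i := fun i =>
    measureReal_mono (delN_mono N ((Set.subset_union_left).trans (hW1C i)))
  have hmb : ∀ i, b ≤ m i := fun i => measureReal_mono (delN_mono N (hW0A i))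
  have hmy : ∀ i, m i ≤ y i := fun i => measureReal_mono (delN_mono N (hW01 i))
  have hVAle : ∀ i, VA ≤ Vv i := fun i => measureReal_mono (Set.inter_subset_inter_left _ (hW0A i))
  have hVv1 : ∀ i, Vv i ≤ 1 - q := fun i => by rw [← hhit]; exact measureReal_mono Set.inter_subset_right
  -- Harris: `VA ≥ (1−q)·μ(A) ≥ (1−q)·b` and `Vv i ≥ (1−q)·m i`
  have hHarrisA : (prodBernoulli p).real A * (1 - q) ≤ VA := by
    rw [← hhit]
    exact prodBernoulli_harris p hu (isUpperSet_hit N) MeasurableSet.of_discrete MeasurableSet.of_discrete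
  have hbVA : (1 - q) * b ≤ VA := by
    have h1 : b ≤ (prodBernoulli p).real A := measureReal_mono (delN_subset N hu)
    nlinarith [hHarrisA, h1, hq1]
  have hmVv : ∀ i, (1 - q) * m i ≤ Vv i := by
    intro i
    have h0 : (prodBernoulli p).real (W0 i) * (1 - q) ≤ Vv i := by
      rw [← hhit]
      exact prodBernoulli_harris p (hW0up i) (isUpperSet_hit N) MeasurableSet.of_discrete MeasurableSet.of_discrete
    have h1 : m i ≤ (prodBernoulli p).real (W0 i) := measureReal_mono (delN_subset N (hW0up i))
    nlinarith [h0, h1, hq1]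
  -- the three product hypotheses
  have hUcap : ∀ i j, i ≠ j → delN N (W1 i) ∩ delN N (W1 j) ⊆ delN N A := by
    intro i j hij
    rw [← delN_inter]
    refine (delN_mono N (hW1cap i j hij)).trans ?_
    rw [delN_union, delN_hit, Set.union_empty]
  have hpu : ∏ i, y i ≤ b ^ (n - 1) := hB n (fun i => delN N (W1 i)) (fun i => isUpperSet_delN N (hW1up i)) hUcap
  have hMcap : ∀ i j, i ≠ j → delN N (W0 i) ∩ delN N (W0 j) ⊆ delN N A := by
    intro i j hij; rw [← delN_inter]; exact delN_mono N (hW0cap i j hij)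
  have hpm : ∏ i, m i ≤ b ^ (n - 1) := hB n (fun i => delN N (W0 i)) (fun i => isUpperSet_delN N (hW0up i)) hMcap
  have hpg : ∏ i, (prodBernoulli p).real (W0 i) ≤ (prodBernoulli p).real A ^ (n - 1) := hA n W0 hW0up hW0cap
  have hpV : ∏ i, Vv i ≤ VA ^ (n - 1) * (1 - q) := by rw [← hhit]; exact hH n W0 hW0up hW0cap
  -- assemble
  have hgoal : ∏ i, (prodBernoulli p).real (W i) ≤ (prodBernoulli p).real C ^ (n - 1) := by
    rw [hCdec, prod_congr rfl fun i _ => hWdec i]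
    simp_rw [hW1dec, hW0dec]
    rcases hq1.lt_or_eq with hqlt | hqone
    · -- `q < 1`: normalise by `1 − q`
      have h1q : 0 < 1 - q := by linarith
      set s : ℝ := 1 - q with hs
      set β : ℝ := VA / s with hβ
      set vv : Fin n → ℝ := fun i => Vv i / s with hvv
      have hVAeq : VA = s * β := by rw [hβ]; field_simp
      have hVveq : ∀ i, Vv i = s * vv i := fun i => by simp only [hvv]; field_simp
      have hfac : ∀ i, t * ((1 - q) + q * y i) + (1 - t) * (Vv i + q * m i) =
          s * t + s * (1 - t) * vv i + (1 - s) * t * y i + (1 - s) * (1 - t) * m i := by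
        intro i; rw [hVveq i, hs]; ring
      have hc : t * ((1 - q) + q * b) + (1 - t) * (VA + q * b) = s * t + s * (1 - t) * β + (1 - s) * b := by
        rw [hVAeq, hs]; ring
      rw [prod_congr rfl fun i _ => hfac i, hc]
      have hs0 : 0 ≤ s := h1q.le
      have hs1 : s ≤ 1 := by rw [hs]; linarith
      have hbβ : b ≤ β := by rw [hβ, le_div_iff₀ h1q]; linarith [hbVA]
      have hvβ : ∀ i, β ≤ vv i := fun i => by
        simp only [hβ, hvv]; exact div_le_div_of_nonneg_right (hVAle i) hs0
      have hpv : ∏ i, vv i ≤ β ^ (n - 1) := by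
        rcases Nat.eq_zero_or_pos n with hn | hn
        · subst hn; simp
        have e1 : ∏ i, vv i = (∏ i, Vv i) / s ^ n := by
          simp only [hvv]; rw [prod_div_distrib, prod_const, card_univ, Fintype.card_fin]
        have e2 : β ^ (n - 1) = VA ^ (n - 1) * s / s ^ n := by
          rw [hβ, div_pow]
          have : s ^ n = s ^ (n - 1) * s := by rw [← pow_succ]; congr 1; omega
          rw [this]; field_simp
        rw [e1, e2]
        exact div_le_div_of_nonneg_right (by rw [hs]; exact hpV) (pow_nonneg hs0 _)
      have hpg' : ∏ i, ((1 - s) * m i + s * vv i) ≤ ((1 - s) * b + s * β) ^ (n - 1) := by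
        have e1 : ∀ i, (1 - s) * m i + s * vv i = (prodBernoulli p).real (W0 i) := by
          intro i; rw [hW0dec i, hVveq i, hs]; ring
        have e2 : (1 - s) * b + s * β = (prodBernoulli p).real A := by rw [hAdec, hVAeq, hs]; ring
        rw [prod_congr rfl fun i _ => e1 i, e2]; exact hpg
      rcases hb0.lt_or_eq with hbpos | hbzero
      · exact Pendant.pendant_prod_le hbpos hbβ hs0 hs1 ht0 ht1 y vv m hyb hvβ hmb hmy hpu hpv hpg'
      · -- `b = 0`
        have hy0 : ∀ i, 0 ≤ y i := fun i => measureReal_nonneg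
        have hU2 : ∀ i j, i ≠ j → y i * y j = 0 := by
          intro i j hij
          have h := prodBernoulli_harris p (isUpperSet_delN N (hW1up i)) (isUpperSet_delN N (hW1up j))
            MeasurableSet.of_discrete MeasurableSet.of_discrete
          have h' := (h.trans (measureReal_mono (hUcap i j hij))).trans_eq hbzero.symm
          exact le_antisymm h' (mul_nonneg (hy0 i) (hy0 j))
        have hV2 : ∀ i j, i ≠ j → vv i * vv j ≤ β := by
          intro i j hij
          have h := hH.pair p (hW0up i) (hW0up j) (hW0cap i j hij)
          rw [hhit] at h
          simp only [hvv, hβ]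
          rw [div_mul_div_comm, div_le_div_iff₀ (mul_pos h1q h1q) h1q]
          nlinarith [h, h1q.le]
        have hvv1 : ∀ i, vv i ≤ 1 := fun i => by
          simp only [hvv]; rw [div_le_one h1q]; exact hVv1 i
        have hmvv : ∀ i, m i ≤ vv i := fun i => by
          simp only [hvv]; rw [le_div_iff₀ h1q, mul_comm]; exact hmVv i
        have hβ0 : 0 ≤ β := div_nonneg hVA0 hs0
        rw [← hbzero, mul_zero, add_zero]
        exact Pendant.pendant_prod_le_zero hβ0 hs0 hs1 ht0 ht1 y vv m hy0 hy1 hvβ hvv1 hm0 hmy hmvv hU2 hV2 hpv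
    · -- `q = 1`: `N` is almost surely missed; every factor is at most `y i`
      have hVAle1 : VA ≤ 1 - q := by rw [← hhit]; exact measureReal_mono Set.inter_subset_right
      have hVA1 : VA = 0 := le_antisymm (by linarith) hVA0
      have hVv1' : ∀ i, Vv i = 0 := fun i => le_antisymm (by linarith [hVv1 i]) (hVv0 i)
      have hfac : ∀ i, t * ((1 - q) + q * y i) + (1 - t) * (Vv i + q * m i) ≤ y i := by
        intro i; rw [hVv1' i, hqone]
        have := mul_le_mul_of_nonneg_left (hmy i) (sub_nonneg.2 ht1)
        linarith
      have hfac0 : ∀ i, 0 ≤ t * ((1 - q) + q * y i) + (1 - t) * (Vv i + q * m i) := by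
        intro i
        have := hVv0 i; have := hm0 i; have : 0 ≤ y i := measureReal_nonneg
        have : 0 ≤ 1 - t := sub_nonneg.2 ht1
        have : 0 ≤ 1 - q := sub_nonneg.2 hq1
        positivity
      calc ∏ i, (t * ((1 - q) + q * y i) + (1 - t) * (Vv i + q * m i)) ≤ ∏ i, y i :=
            prod_le_prod (fun i _ => hfac0 i) fun i _ => hfac i
        _ ≤ b ^ (n - 1) := hpu
        _ = (t * ((1 - q) + q * b) + (1 - t) * (VA + q * b)) ^ (n - 1) := by rw [hVA1, hqone]; ring
  exact le_trans (prod_le_prod (fun i _ => measureReal_nonneg) fun i _ => hmono i) hgoal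

/-! ## A-safety version -/

omit [Fintype ι] in
/-- `delN (insert x N) = delMinor x ∘ delN N`. [this work] -/
theorem delN_insert [Fintype ι] (x : ι) (N : Finset ι) (X : Set (Set ι)) :
    delN (insert x N) X = delMinor x (delN N X) := by
  ext ω
  simp only [delN, delMinor, secOff, Set.mem_setOf_eq, Finset.coe_insert]
  rw [Set.sdiff_sdiff, Set.singleton_union]

/-- `delN N` of an A-safe up-set is A-safe (iterate `aSafe_delMinor`). [this work] -/
theorem aSafe_delN {A : Set (Set ι)} (hu : IsUpperSet A) (hA : ∀ q : ι → unitInterval, Safe q A) (N : Finset ι) :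
    ∀ q : ι → unitInterval, Safe q (delN N A) := by
  classical
  induction N using Finset.induction_on with
  | empty =>
    have : delN (∅ : Finset ι) A = A := by ext ω; simp [delN]
    rw [this]; exact hA
  | insert x N hx ih =>
    rw [delN_insert]
    exact aSafe_delMinor (isUpperSet_delN N hu) ih x

/-- **A-SAFETY IS PRESERVED BY ATTACHING A VERTEX, GIVEN HIT-CONDITIONED SAFETY**: `z ∉ N`, `A` an A-safe up-set not depending
on `z` that is hit-conditioned safe w.r.t. `N` at every `p` ⟹ `A ∪ {ω | z ∈ ω ∧ ω meets N}` is A-safe. [this work] -/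
theorem aSafe_union_attach {z : ι} {N : Finset ι} (hz : z ∉ N) {A : Set (Set ι)}
    (hd : DeterminedBy A (↑(univ.erase z : Finset ι) : Set ι)) (hu : IsUpperSet A) (hA : ∀ q : ι → unitInterval, Safe q A)
    (hH : ∀ q : ι → unitInterval, HitSafe q N A) (q : ι → unitInterval) : Safe q (A ∪ attachEv z N) :=
  safe_union_attach q hz hd hu (hA q) (aSafe_delN hu hA N q) (hH q)

end Attach

/-! ## Graph form: attaching a new vertex to a set of old vertices -/

section Graph

open Attach

/-- The star of edges `{z x : x ∈ N}`. [this work] -/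
def starEdges (z : ι) (N : Finset ι) : SimpleGraph ι := SimpleGraph.fromEdgeSet ((fun x => s(z, x)) '' (↑N : Set ι))

omit [Fintype ι] [DecidableEq ι] in
/-- The core of `Γ₀` plus the star at `z` over `N` (`z ∉ N`) is the core of `Γ₀` together with "`z` open and `N` met". [this work] -/
theorem edgeCore_sup_starEdges (Γ₀ : SimpleGraph ι) {z : ι} {N : Finset ι} (hz : z ∉ N) :
    edgeCore (Γ₀ ⊔ starEdges z N) = edgeCore Γ₀ ∪ attachEv z N := by
  ext ω
  simp only [edgeCore, starEdges, SimpleGraph.sup_adj, SimpleGraph.fromEdgeSet_adj, Set.mem_image, Finset.mem_coe,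
    Set.mem_setOf_eq, Set.mem_union, attachEv, hit, Set.mem_inter_iff]
  constructor
  · rintro ⟨u, v, h | ⟨⟨x, hxN, hx⟩, hne⟩, hu, hv⟩
    · exact Or.inl ⟨u, v, h, hu, hv⟩
    · rcases Sym2.eq_iff.1 hx with ⟨rfl, rfl⟩ | ⟨rfl, rfl⟩
      · exact Or.inr ⟨hu, x, hxN, hv⟩
      · exact Or.inr ⟨hv, x, hxN, hu⟩
  · rintro (⟨u, v, h, hu, hv⟩ | ⟨hzω, x, hxN, hxω⟩)
    · exact ⟨u, v, Or.inl h, hu, hv⟩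
    · have hne : z ≠ x := fun h => hz (h ▸ hxN)
      exact ⟨z, x, Or.inr ⟨⟨x, hxN, rfl⟩, hne⟩, hzω, hxω⟩

/-- `↑(univ.erase z)` is the complement of `{z}`. [this work] -/
theorem coe_univ_erase_eq_compl (z : ι) : (↑(univ.erase z : Finset ι) : Set ι) = (↑({z} : Finset ι) : Set ι)ᶜ := by
  ext x; simp

/-- **An A-safe graph plus a new vertex attached to `N` is A-safe, given hit-conditioned safety w.r.t. `N`.**  If `z` is
isolated in `Γ₀`, `z ∉ N`, `edgeCore Γ₀` is A-safe and `HitSafe q N (edgeCore Γ₀)` for every `q`, then the core of `Γ₀ ⊔ {zx : x ∈ N}`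
is A-safe.  (With `TriangleFreeSafe` in view: `N` independent keeps the graph triangle-free; memo §6, THEOREM 4.) [this work] -/
theorem aSafe_edgeCore_attach (Γ₀ : SimpleGraph ι) {z : ι} {N : Finset ι} (hzN : z ∉ N) (hz : ∀ w, ¬ Γ₀.Adj z w)
    (hsafe : ∀ q : ι → unitInterval, Safe q (edgeCore Γ₀)) (hH : ∀ q : ι → unitInterval, HitSafe q N (edgeCore Γ₀))
    (p' : ι → unitInterval) : Safe p' (edgeCore (Γ₀ ⊔ starEdges z N)) := by
  classical
  rw [edgeCore_sup_starEdges Γ₀ hzN]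
  have hd : DeterminedBy (edgeCore Γ₀) (↑(univ.erase z : Finset ι) : Set ι) := by
    rw [coe_univ_erase_eq_compl]; exact determinedBy_edgeCore_of_isolated_one Γ₀ hz
  exact aSafe_union_attach hzN hd (isUpperSet_edgeCore Γ₀) hsafe hH p'

end Graph

end SafeCalc

end Summit.CriticalPhenomena.PercolationContinuityZ3.Theorems.SunflowerPartition
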